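import Summits.BirchSwinnertonDyer.BirchSwinnertonDyer.Theorems.SchneiderFreeAdditiveX3BadPrimeCharImprimitiveShift
import Summits.BirchSwinnertonDyer.BirchSwinnertonDyer.Theorems.SchneiderFreeAdditiveX3AnomalousTwistLambdaLEOffP
import Summits.BirchSwinnertonDyer.BirchSwinnertonDyer.Theorems.SchneiderFreeAdditiveX3AnomalousTwistOrientation
import Summits.BirchSwinnertonDyer.BirchSwinnertonDyer.Theorems.SchneiderFreeAdditiveX3LocalTowerTorsionFiniteX3
import Summits.BirchSwinnertonDyer.BirchSwinnertonDyer.Theorems.SchneiderFreeAdditiveX3AnticycControlAdditiveStubNoLocalPTorsionOfAtoms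
import HarnessLib

/-!
# Route `SchneiderFreeAdditiveX3` (K1 door), crux r3 `GordTwoBranchIMC` (stmt-BirchSwinnertonDyer-19177): **THE ALGEBRAIC SIDE OF THE
# ANOMALOUS TWIN IN THE PRIMITIVE CHARACTER CURRENCY** — `λ(𝔛_nr(θsub)) + λ(𝔛_nr(θquot)) + Σ_{w∈Sf}(λ𝒫_w(θsub) + λ𝒫_w(θquot)) ≤
# λ(𝔛^{Sf}(W_K)) + [θquot = 𝟙]` for the anomalous `(−3)`-twist, `Sf` the `3`-free places over `N_W`, kernel modulo Greenberg ×5 +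
# `cd_3(G_{K,Σ}) ≤ 2` BY NAME; and the DOOR-CURRENCY form on the (G-ord, `e = 2`) cell at `3` with every local binder discharged

Cell `bsd-schneider-ideate`, seat `bsd-schneider-door-c5` (prover, generation 31; assembly layer; `--supports` 19177, helper).
PARTITION: board row B6 ∩ X3 ∩ sst-twist, `r = 1` — the 1 725 ANOMALOUS pairs of the (G-ord, `e = 2`) half at `p = 3` (of 2 411).
bears_on: K1-door (items 18971/18972 retired → 19177 r3).  FILE 11 (last) of the anomalous-twin port (FINDING-door-c5-g28 §5b `stub_λW`) = the door
analogue of x2-p2 g10's `SplitMultAlgebraicSide`, i.e. generation 24's NAT «door inequality» (`KYLambdaAlgChar` §9) for the ANOMALOUS twin: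
* §1 `lambdaInvariant_primitive_add_sum_le_of_anomalousTwist` — FILE 7's imprimitive `λ`-inequality + FILE 10's Prop. 1.2.5 shifts for both
  characters; the cotorsion of the imprimitive character duals now FOLLOWS from [RH] for the PRIMITIVE ones (`hRHsub`, `hRHquot`: every primitive dual
  datum of `H¹_{𝓕_nr}(K_∞, (F/𝒪)(θ))` f.g. `Λ`-torsion with `μ = 0` — on the door: bsd-eis's typed `KellerYin2024.thm122_rubinHida_residualPair_unrSelmer`
  read at the good partner, generation 28 F13/F14), while «`𝔛^{Sf}(W_K)` f.g. torsion `μ = 0`» stays displayed ([INV.μ], generation 28's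
  `AnomalousTwistMuZero.…_of_sharedPair`);
* §2 `lambdaInvariant_primitive_add_sum_le_three_of_anomalousTwist_of_normalised` — the DOOR CURRENCY: `W` globally minimal on the cell
  (`ClassX3 W 3`, `SubGordTwo W 3`), `r_an(W) = 1`, an anomalous good-ordinary `(−3)`-twist model `(V, C)`, Keller–Yin's normalisation
  «every rational `3`-line `D₃`-non-trivial», `K` with (Heeg) for `N_W`, ANY residual pair; orientation + `W(K)[3] = 0` by FILE 8b, Fin_v by the
  door's CLOSED crux r5 `localTowerTorsionFiniteX3_proof` (19546), `3` split by `splitsIn_of_satisfiesHeegnerHypothesis`.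
INPUT LEDGER of the anomalous twin's LOWER λ-algebra (per pair, `p = 3`): BEFORE (FINDING-door-c5-g28 §5b) «stub_λW — NOT in print, no tree road»;
AFTER ⟸ {Greenberg 2016 Prop. 2.6.3; Greenberg 2006 Props. 4.1, 4.2, §5 A, 3.2; NSW (8.3.18)} PUB by name ∪ {[RH] ×2 (bsd-eis typed),
[INV.μ] (generation 28, itself ⟸ [RH]+[PWL-θ])} — the residue SHAPE of the NAT door's λ-algebra (generation 24) and of bsd-eis's good-lattice road.

HONEST FRAMING: composition theorems CONDITIONAL BY NAME on six published facts typed as `Prop`s and on the displayed [RH]/[INV.μ] clauses;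
nothing analytic (no `𝓛`, no congruence, no branch main conjecture — [AN3-anom] and [BR] remain exactly as in FINDING-door-c5-g28 §5b); no
registered stub of 19177's skeleton v10b is closed; no item closed; BSD proved for no curve; «closes rung: none».
References: Keller–Yin arXiv:2402.12781v2 Thm. 1.4.1 (iii), Prop. 1.2.5; arXiv:2410.23241 §3.3 [KellerYin2024]; [CastellaGrossiLeeSkinner2022]
Prop. 1.2.5; [Greenberg2016Selmer] Prop. 2.6.3; [Greenberg2006] Props. 3.2, 4.1, 4.2, §5 A; [NeukirchSchmidtWingberg2008] (8.3.18);
[JetchevSkinnerWan2017] Prop. 3.3.4 (Fin_v); x2 `SplitMultAlgebraicSide` (template).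
-/

set_option autoImplicit false
-- the route's Theorems namespace repeats the summit name by design (D-0017 nested layout)
set_option linter.dupNamespace false

noncomputable section

open scoped Classical
open NumberField IsDedekindDomain Field Multiplicative PowerSeries WeierstrassCurve
open Literature.NumberTheory.EllipticCurves Literature.NumberTheory.EllipticCurves.GreenbergSelmer
  Literature.NumberTheory.EllipticCurves.GreenbergVatsal2000 Literature.NumberTheory.GaloisRepresentations
  Literature.NumberTheory.EllipticCurves.KellerYin2024 Literature.NumberTheory.EllipticCurves.IwasawaDual
  Literature.NumberTheory.IwasawaTheory Literature.NumberTheory.IwasawaTheory.Greenberg2016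
  Literature.NumberTheory.IwasawaTheory.Greenberg2006 Literature.NumberTheory.EllipticCurves.Castella2018
  Literature.NumberTheory.GaloisCohomology
  Literature.NumberTheory.EllipticCurves.Rank1Residual
  Summit.BirchSwinnertonDyer.Rank1Residual Summit.BirchSwinnertonDyer.Rank1Residual.Additive
  Summit.BirchSwinnertonDyer.BirchSwinnertonDyer.Theorems
  Summit.BirchSwinnertonDyer.BirchSwinnertonDyer.Theorems.SchneiderFreeAdditiveX3

namespace Summit.BirchSwinnertonDyer.BirchSwinnertonDyer.Theorems.SchneiderFreeAdditiveX3.AnomalousTwistAlgebraicSide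

variable {K : Type} [Field K] [NumberField K] {p : ℕ} [hp : Fact p.Prime]

/-! ## §1. Primitive currency, explicit binders -/

/-- **THE ALGEBRAIC SIDE OF THE ANOMALOUS TWIN, PRIMITIVE CURRENCY.** `V/ℚ` globally minimal good ordinary at `p = 3` with `3 ∣ a₃(V) − 1`,
`W = C • V^{(p*)}` globally minimal ADDITIVE at `3`, `K` imaginary quadratic with (Heeg) for `N_W` and `3 = v v̄`, `W(K)[3] = 0`, `v` through `ι`,
`κ` anticyclotomic with topological generator `γ`, a residual pair `(θsub, θquot)` with `θsub` NON-TRIVIAL on `D_v̄`, Fin_v `hfinED`, `Sf` the `3`-free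
places over `N_W`, PRIMITIVE dual data `Dsub`, `Dquot` (`S = ∅`), [RH] for both characters (every primitive dual datum f.g. `Λ`-torsion `μ = 0`),
and `𝔛^{Sf}(W_K)` f.g. `Λ`-torsion with `μ = 0`; GRANTED the six named PUB facts:
`λ(Dsub.X) + λ(Dquot.X) + Σ_{w∈Sf}(λ𝒫_w(θsub) + λ𝒫_w(θquot)) ≤ λ(𝔛^{Sf}(W_K)) + [θquot = 𝟙]`.
[cite: KellerYin2024, Thm. 1.4.1 (iii), Prop. 1.2.5 (arXiv:2402.12781v2)] [cite: CastellaGrossiLeeSkinner2022, Prop. 1.2.5, proof of Thm. 1.5.1 (eq:lambda-imp)]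
[cite: Greenberg2016Selmer, Prop. 2.6.3] [cite: Greenberg2006, Props. 3.2, 4.1, 4.2, §5 A] [cite: NeukirchSchmidtWingberg2008, (8.3.18)] -/
theorem lambdaInvariant_primitive_add_sum_le_of_anomalousTwist {V : WeierstrassCurve ℚ} [V.IsElliptic] [V.IsGloballyMinimal]
    (h263 : prop263_sur_of_crk) (h41 : prop41_globalEulerPoincareCorank)
    (h42 : prop42_localEulerPoincareCorank) (h5A : sec5A_localH2_subsingleton_of_LOC1)
    (h32 : prop32_cohomology_isCofinitelyGenerated)
    (W : WeierstrassCurve ℚ) [W.IsElliptic] [W.IsGloballyMinimal]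
    (hp3 : p = 3) (hV : GoodOrd V p) (ha : (p : ℤ) ∣ V.frobeniusTrace p - 1)
    (C : VariableChange ℚ) (hC : C • V.quadraticTwist ((-1 : ℚ) ^ (p / 2) * p) = W) (haddv : Addv W p)
    (hK : IsImaginaryQuadratic K) (hCD2 : groupCdLE_two_galoisGroupUnramifiedOutside K)
    (hH : SatisfiesHeegnerHypothesis (W.conductorNorm ℤ) K)
    (htor : ∀ Q : (W.baseChange K).toAffine.Point, p • Q = 0 → Q = 0)
    (ι : K →+* ℚ_[p]) (v vbar : HeightOneSpectrum (𝓞 K))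
    (hv : ∀ x : 𝓞 K, x ∈ v.asIdeal ↔ ‖ι (x : K)‖ < 1)
    (hvbar : ((p : ℕ) : 𝓞 K) ∈ vbar.asIdeal) (hne : vbar ≠ v)
    (κ : ZpExtension K p) (hκ : κ.IsAnticyclotomic)
    (γ : absoluteGaloisGroup K) [Fact (κ.IsTopGenerator γ)]
    (θsub θquot : FramedGaloisRep K (padicCoeffIntegers (∅ : Set (PadicAlgCl p))) 1)
    (hpair : IsResidualPairOver (W.baseChange K) p θsub θquot)
    (hram : ∃ τ ∈ decomp vbar, unitChar θsub τ ≠ 1)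
    (hfinED : Finite {x : ↥((W.baseChange K).geomPrimaryTorsion p) // ∀ g : ↥(κ.kerSubgroup ⊓ decomp vbar), g • x = x})
    (Sf : Finset (HeightOneSpectrum (𝓞 K)))
    (hSf : ∀ w : HeightOneSpectrum (𝓞 K), w ∈ Sf ↔
      (((W.conductorNorm ℤ : ℤ) : 𝓞 K) ∈ w.asIdeal ∧ ((p : ℕ) : 𝓞 K) ∉ w.asIdeal))
    (Dsub : DatumDualData κ γ (charModule ∅ θsub)
        (AcSelmer.bdpData (charModule ∅ θsub) p vbar) (∅ : Set (HeightOneSpectrum (𝓞 K))))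
    (Dquot : DatumDualData κ γ (charModule ∅ θquot)
        (AcSelmer.bdpData (charModule ∅ θquot) p vbar) (∅ : Set (HeightOneSpectrum (𝓞 K))))
    (hfgS : Module.Finite (IwasawaAlgebra p) (AcSelmer.XAc (W.baseChange K) p κ vbar (↑Sf : Set (HeightOneSpectrum (𝓞 K))) γ))
    (htorS : Module.IsTorsion (IwasawaAlgebra p) (AcSelmer.XAc (W.baseChange K) p κ vbar (↑Sf : Set (HeightOneSpectrum (𝓞 K))) γ))
    (hμS : muInvariant p (AcSelmer.XAc (W.baseChange K) p κ vbar (↑Sf : Set (HeightOneSpectrum (𝓞 K))) γ) = 0)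
    (hRHsub : ∀ D : DatumDualData κ γ (charModule ∅ θsub)
        (AcSelmer.bdpData (charModule ∅ θsub) p vbar) (∅ : Set (HeightOneSpectrum (𝓞 K))),
      Module.Finite (IwasawaAlgebra p) D.X ∧ Module.IsTorsion (IwasawaAlgebra p) D.X ∧ muInvariant p D.X = 0)
    (hRHquot : ∀ D : DatumDualData κ γ (charModule ∅ θquot)
        (AcSelmer.bdpData (charModule ∅ θquot) p vbar) (∅ : Set (HeightOneSpectrum (𝓞 K))),
      Module.Finite (IwasawaAlgebra p) D.X ∧ Module.IsTorsion (IwasawaAlgebra p) D.X ∧ muInvariant p D.X = 0) :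
    lambdaInvariant p Dsub.X + lambdaInvariant p Dquot.X +
        ∑ w ∈ Sf, (charLocalLambda ∅ κ θsub w + charLocalLambda ∅ κ θquot w) ≤
      lambdaInvariant p (AcSelmer.XAc (W.baseChange K) p κ vbar (↑Sf : Set (HeightOneSpectrum (𝓞 K))) γ) +
        (if ∀ σ : absoluteGaloisGroup K, θquot σ = 1 then 1 else 0) := by
  have hγ : κ.IsTopGenerator γ := Fact.out
  have hp : 2 < p := by omega
  -- imprimitive dual data over `Sf` exist
  obtain ⟨DSsub⟩ := nonempty_unrDualData_char (∅ : Set (PadicAlgCl p)) θsub κ vbar (↑Sf : Set (HeightOneSpectrum (𝓞 K))) hγ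
  obtain ⟨DSquot⟩ := nonempty_unrDualData_char (∅ : Set (PadicAlgCl p)) θquot κ vbar (↑Sf : Set (HeightOneSpectrum (𝓞 K))) hγ
  -- Prop. 1.2.5 at the bad prime for both characters: cotorsion of every imprimitive datum and the `λ`-shifts
  have hsubP := fun DS ↦ BadPrimeCharImprimitiveShift.imprimitive_clauses_of_not_good h263 h41 h42 h5A h32 W hp haddv.1 hK hH hv hvbar hne κ hκ
    γ hpair Sf hSf θsub (Or.inl rfl) hRHsub Dsub DS
  have hquotP := fun DS ↦ BadPrimeCharImprimitiveShift.imprimitive_clauses_of_not_good h263 h41 h42 h5A h32 W hp haddv.1 hK hH hv hvbar hne κ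
    hκ γ hpair Sf hSf θquot (Or.inr rfl) hRHquot Dquot DS
  have hSsub : ∀ DS : DatumDualData κ γ (charModule ∅ θsub)
      (AcSelmer.bdpData (charModule ∅ θsub) p vbar) (↑Sf : Set (HeightOneSpectrum (𝓞 K))),
      Module.Finite (IwasawaAlgebra p) DS.X ∧ Module.IsTorsion (IwasawaAlgebra p) DS.X ∧ muInvariant p DS.X = 0 := fun DS ↦
    ⟨(hsubP DS).1, (hsubP DS).2.1, (hsubP DS).2.2.1⟩
  have hSquot : ∀ DS : DatumDualData κ γ (charModule ∅ θquot)
      (AcSelmer.bdpData (charModule ∅ θquot) p vbar) (↑Sf : Set (HeightOneSpectrum (𝓞 K))),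
      Module.Finite (IwasawaAlgebra p) DS.X ∧ Module.IsTorsion (IwasawaAlgebra p) DS.X ∧ muInvariant p DS.X = 0 := fun DS ↦
    ⟨(hquotP DS).1, (hquotP DS).2.1, (hquotP DS).2.2.1⟩
  have hlsub : lambdaInvariant p DSsub.X = lambdaInvariant p Dsub.X + ∑ w ∈ Sf, charLocalLambda ∅ κ θsub w := (hsubP DSsub).2.2.2
  have hlquot : lambdaInvariant p DSquot.X = lambdaInvariant p Dquot.X + ∑ w ∈ Sf, charLocalLambda ∅ κ θquot w := (hquotP DSquot).2.2.2
  -- KY Thm. 1.4.1 (iii) for the anomalous twist, imprimitive duals (FILE 7)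
  have hmain := AnomalousTwistLambdaLEOffP.lambdaInvariant_add_le_of_anomalousTwist_offP h263 h41 h42 h5A h32 W p hp3 hV ha C hC haddv K hK
    hCD2 hH htor ι v vbar hv hvbar hne κ hκ γ θsub θquot hpair hram hfinED Sf hSf DSsub DSquot hfgS htorS hμS hSsub hSquot
  rw [hlsub, hlquot] at hmain
  rw [Finset.sum_add_distrib]
  omega

/-! ## §2. The door currency: the (G-ord, `e = 2`) cell at `3`, anomalous twist class, Keller–Yin-normalised member -/

/-- **THE ALGEBRAIC SIDE OF THE ANOMALOUS TWIN ON THE (G-ord, `e = 2`) CELL OF B6 ∩ X3 AT `p = 3`, PRIMITIVE CURRENCY, every local binder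
discharged.**  DATA: `W/ℚ` globally minimal, `ClassX3 W 3`, `SubGordTwo W 3`, `r_an(W) = 1`; an anomalous good-ordinary `(−3)`-twist model
`W = C • V^{(3*)}` (`GoodOrd V 3`, `3 ∣ a₃(V) − 1`); Keller–Yin's normalisation «every rational `3`-line of `W` is `D₃`-non-trivial»; `K` imaginary
quadratic with (Heeg) for `N_W`, `v` through `ι`, `v̄ ≠ v`; `κ` anticyclotomic, `γ`; ANY residual pair `(θsub, θquot)` of `W_K[3]`; `Sf` the `3`-free
places over `N_W`; primitive dual data; [RH] for both characters and «`𝔛^{Sf}(W_K)` f.g. torsion `μ = 0`» displayed; six PUB facts by name.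
CONCLUSION: `λ(Dsub.X) + λ(Dquot.X) + Σ_{w∈Sf}(λ𝒫_w(θsub) + λ𝒫_w(θquot)) ≤ λ(𝔛^{Sf}(W_K)) + [θquot = 𝟙]`.  (Orientation and `W(K)[3] = 0`:
FILE 8b; Fin_v: `localTowerTorsionFiniteX3_proof`, the only use of `r_an = 1`; `3` split: `splitsIn_of_satisfiesHeegnerHypothesis`.)
[cite: KellerYin2024, Thm. 1.4.1 (iii), Prop. 1.2.5 (arXiv:2402.12781v2); arXiv:2410.23241 §3.3] [cite: Greenberg2016Selmer, Prop. 2.6.3]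
[cite: Greenberg2006, Props. 3.2, 4.1, 4.2, §5 A] [cite: NeukirchSchmidtWingberg2008, (8.3.18)] [cite: JetchevSkinnerWan2017, §3.3 Prop. 3.3.4 Case 3(b)] -/
theorem lambdaInvariant_primitive_add_sum_le_three_of_anomalousTwist_of_normalised
    (h263 : prop263_sur_of_crk) (h41 : prop41_globalEulerPoincareCorank)
    (h42 : prop42_localEulerPoincareCorank) (h5A : sec5A_localH2_subsingleton_of_LOC1)
    (h32 : prop32_cohomology_isCofinitelyGenerated)
    (W : WeierstrassCurve ℚ) [W.IsElliptic] [W.IsGloballyMinimal]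
    (hr : W.analyticRank = 1) (hX : ClassX3 W 3) (hSG : SubGordTwo W 3)
    {V : WeierstrassCurve ℚ} [V.IsElliptic] [V.IsGloballyMinimal] (hV : GoodOrd V 3) (ha : (3 : ℤ) ∣ V.frobeniusTrace 3 - 1)
    (C : VariableChange ℚ) (hC : C • V.quadraticTwist ((-1 : ℚ) ^ ((3 : ℕ) / 2) * ((3 : ℕ) : ℚ)) = W)
    (hnorm : ∀ Ψ : AddSubgroup (geomTorsion W ((3 : ℕ) : ℤ)), IsRationalLine W 3 Ψ → ¬ LineDecompositionTrivialAt W 3 Ψ)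
    (hK : IsImaginaryQuadratic K) (hCD2 : groupCdLE_two_galoisGroupUnramifiedOutside K)
    (hH : SatisfiesHeegnerHypothesis (W.conductorNorm ℤ) K)
    (ι : K →+* ℚ_[3]) (v vbar : HeightOneSpectrum (𝓞 K))
    (hv : ∀ x : 𝓞 K, x ∈ v.asIdeal ↔ ‖ι (x : K)‖ < 1)
    (hvbar : ((3 : ℕ) : 𝓞 K) ∈ vbar.asIdeal) (hne : vbar ≠ v)
    (κ : ZpExtension K 3) (hκ : κ.IsAnticyclotomic)
    (γ : absoluteGaloisGroup K) [Fact (κ.IsTopGenerator γ)]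
    (θsub θquot : FramedGaloisRep K (padicCoeffIntegers (∅ : Set (PadicAlgCl 3))) 1)
    (hpair : IsResidualPairOver (W.baseChange K) 3 θsub θquot)
    (Sf : Finset (HeightOneSpectrum (𝓞 K)))
    (hSf : ∀ w : HeightOneSpectrum (𝓞 K), w ∈ Sf ↔
      (((W.conductorNorm ℤ : ℤ) : 𝓞 K) ∈ w.asIdeal ∧ ((3 : ℕ) : 𝓞 K) ∉ w.asIdeal))
    (Dsub : DatumDualData κ γ (charModule ∅ θsub)
        (AcSelmer.bdpData (charModule ∅ θsub) 3 vbar) (∅ : Set (HeightOneSpectrum (𝓞 K))))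
    (Dquot : DatumDualData κ γ (charModule ∅ θquot)
        (AcSelmer.bdpData (charModule ∅ θquot) 3 vbar) (∅ : Set (HeightOneSpectrum (𝓞 K))))
    (hfgS : Module.Finite (IwasawaAlgebra 3) (AcSelmer.XAc (W.baseChange K) 3 κ vbar (↑Sf : Set (HeightOneSpectrum (𝓞 K))) γ))
    (htorS : Module.IsTorsion (IwasawaAlgebra 3) (AcSelmer.XAc (W.baseChange K) 3 κ vbar (↑Sf : Set (HeightOneSpectrum (𝓞 K))) γ))
    (hμS : muInvariant 3 (AcSelmer.XAc (W.baseChange K) 3 κ vbar (↑Sf : Set (HeightOneSpectrum (𝓞 K))) γ) = 0)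
    (hRHsub : ∀ D : DatumDualData κ γ (charModule ∅ θsub)
        (AcSelmer.bdpData (charModule ∅ θsub) 3 vbar) (∅ : Set (HeightOneSpectrum (𝓞 K))),
      Module.Finite (IwasawaAlgebra 3) D.X ∧ Module.IsTorsion (IwasawaAlgebra 3) D.X ∧ muInvariant 3 D.X = 0)
    (hRHquot : ∀ D : DatumDualData κ γ (charModule ∅ θquot)
        (AcSelmer.bdpData (charModule ∅ θquot) 3 vbar) (∅ : Set (HeightOneSpectrum (𝓞 K))),
      Module.Finite (IwasawaAlgebra 3) D.X ∧ Module.IsTorsion (IwasawaAlgebra 3) D.X ∧ muInvariant 3 D.X = 0) :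
    lambdaInvariant 3 Dsub.X + lambdaInvariant 3 Dquot.X +
        ∑ w ∈ Sf, (charLocalLambda ∅ κ θsub w + charLocalLambda ∅ κ θquot w) ≤
      lambdaInvariant 3 (AcSelmer.XAc (W.baseChange K) 3 κ vbar (↑Sf : Set (HeightOneSpectrum (𝓞 K))) γ) +
        (if ∀ σ : absoluteGaloisGroup K, θquot σ = 1 then 1 else 0) := by
  have h32' : (3 : ℕ) ≠ 2 := by decide
  have hpvK : ((3 : ℕ) : 𝓞 K) ∈ v.asIdeal := IndexPlumbingNrVsStrict.natCast_mem_asIdeal_of_forall_norm_iff hv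
  have haddv : Addv W 3 := hX.2
  have hpN : 3 ∣ W.conductorNorm ℤ := (W.dvd_conductorNorm_iff_not_hasGoodReductionAtPrime 3).mpr haddv.1
  have hsplit : X11b.SplitsIn K 3 := splitsIn_of_satisfiesHeegnerHypothesis rfl hH hpN
  have hram : ∃ τ ∈ decomp vbar, unitChar θsub τ ≠ 1 :=
    AnomalousTwistOrientation.exists_mem_decomp_unitChar_ne_one_of_anomalousTwist_of_normalised rfl hV ha C hC hnorm hX.1 hK hpvK
      hvbar hne hpair
  have htor : ∀ Q : (W.baseChange K).toAffine.Point, 3 • Q = 0 → Q = 0 :=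
    AnomalousTwistOrientation.forall_baseChange_nsmul_eq_zero_of_anomalousTwist_of_normalised rfl hV ha C hC hnorm hX.1 hK hpvK hvbar hne
  have hfinED : Finite {x : ↥((W.baseChange K).geomPrimaryTorsion 3) // ∀ g : ↥(κ.kerSubgroup ⊓ decomp vbar), g • x = x} := by
    have hfin := localTowerTorsionFiniteX3_proof W 3 hr h32' hX (Or.inr hSG) K hK hsplit κ hκ vbar hvbar
    haveI := hfin.to_subtype
    refine Finite.of_injective (fun x ↦ (⟨x.1, (FixedPoints.mem_addSubgroup _ _ _).mpr fun g ↦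
      x.2 ⟨g.1, Subgroup.mem_inf.mpr (Subgroup.mem_inf.mp g.2).symm⟩⟩ :
        ↥(FixedPoints.addSubgroup ↥(decomp vbar ⊓ κ.kerSubgroup) ((W.baseChange K).geomPrimaryTorsion 3)))) fun a b hab ↦ ?_
    have h := congrArg Subtype.val hab
    exact Subtype.ext h
  exact lambdaInvariant_primitive_add_sum_le_of_anomalousTwist h263 h41 h42 h5A h32 W rfl hV ha C hC haddv hK hCD2 hH htor ι v vbar hv hvbar
    hne κ hκ γ θsub θquot hpair hram hfinED Sf hSf Dsub Dquot hfgS htorS hμS hRHsub hRHquot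

end Summit.BirchSwinnertonDyer.BirchSwinnertonDyer.Theorems.SchneiderFreeAdditiveX3.AnomalousTwistAlgebraicSide

end
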